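import Mathlib
import HarnessLib
import Literature.Analysis.FluidPDE.NSViscosityRescaling
import Literature.Analysis.FluidPDE.NSLerayHopfABCScaling
import Literature.Analysis.FluidPDE.EulerTimeScaling
import Literature.Analysis.FluidPDE.LocalTypeIReverseTools
import Summits.NavierStokesRegularity.NavierStokesRegularity.Theses.QuarterBudgetTrace
import Summits.NavierStokesRegularity.NavierStokesRegularity.Theorems.LerayQuarterDissipationRecordTimeTypeI
import Summits.NavierStokesRegularity.NavierStokesRegularity.Theorems.TerminalTraceTypeITraceScarL3StubExtinctApexOfL3Trace
import Summits.NavierStokesRegularity.NavierStokesRegularity.Theorems.QuarterBudgetTraceZoomBudgetInheritance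
import Summits.NavierStokesRegularity.NavierStokesRegularity.Theorems.QuarterBudgetTraceExtinctApexOfFE

/-!
# Route QuarterBudgetTrace — support `BudgetedExtinctApex` (stmt-NavierStokesRegularity-26014), BY NAME

Seat ns-es-p1 g3 (director-ns KEY-NS #81 (1)); planner of record ns-idea-9 g2 (route header «#9 BudgetedExtinctApex», critic
idea-crit-8 V20).  In the frame (classical on `[0,T)` with viscosity `ν`, Leray–Hopf, rapidly decaying datum) a QUARTER-LAW blow-up
(`∫⁻|curl u(t)|² ≤ K/√(T−t)` on `[0,T)`) with an ENERGY-FLAT terminal trace at `x₀` and the ε-regularity singular clause at `(T, x₀)`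
zooms to a BUDGETED extinct Type-I apex: the six-clause apex package of `typeITraceScarL3_of_loud` + the slab enstrophy budget
`∫⁻_{(−r²,0)×ℝ³} ‖G‖ₑ² ≤ K′r` (all `r > 0`) + `IsBackwardSingularPoint U 0`.

Assembly (`budgetedExtinctApex`), following the tree's `stub_extinctApexD_of_L3trace` (ν-normalisation template):
1. the velocity Type-I rate from the quarter law — `lerayQuarterDissipation_recordTimeTypeI_proof` (RecordTimeTypeI, landed);
2. the singular clause (`r² < T`) extends to every `r` by monotonicity ⇒ `¬ IsBackwardBoundedAt u T x₀`
   (`not_isBackwardBoundedAt_of_forall_eLpNorm_top`);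
3. ν-normalisation `v(s,x) = ν⁻¹ u(s/ν, x)` (blow-up time `νT`; `IsClassicalNSSolutionOn.viscosityRescale_set`,
   `IsLerayHopfOn.viscosityRescale`, the Type-I rate with constant `C/√ν`, `not_isBackwardBoundedAt_viscosityRescale`), under which
   the energy flatness at `x₀` is preserved (factor `ν⁻²`) and the quarter law becomes `∫⁻|curl v(s)|² ≤ K⁺ν^{-3/2}/√(νT−s)`
   (`curl_const_smul_field`);
4. brick (b) `…QuarterBudgetTraceExtinctApexOfFE.extinctApexD_zoomData_unit_const_of_FE` — the package with plain pressure bound and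
   the zoom data; brick (a) `…QuarterBudgetTraceZoomBudgetInheritance.slabBudget_of_zoomLimit` — the budget with `K′ = 2K⁺ν^{-3/2}`
   (finiteness of `∫∫_{Q(a)}|G|²` from `𝐈(Q(a)) ≤ M` via `cknE_le_abScaledSum`, `abScaledSum_le_typeIBound`).

WHAT THIS IS NOT: not a proof of Navier–Stokes regularity and not progress on the route's OPEN cruxes `EnstrophyQuarterLaw` (1574)
/ `NoTraceConcentration` (18381), both consequences of regularity used toward it; with `noBudgetedExtinctApex` (26015, landed) it
yields only the conditional theorem «a quarter-law first blow-up leaves a positive scaled-energy scar at some point of u(T)».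
No summit statement is proved here.
-/

noncomputable section

-- the summit and its single sub-problem share the name (CONVENTIONS §1), as in every Theorems file
set_option linter.dupNamespace false

namespace Summit.NavierStokesRegularity.NavierStokesRegularity.Theorems.QuarterBudgetTraceBudgetedExtinctApex

open MeasureTheory Set Function Filter Topology TopologicalSpace Metric
open scoped NNReal ENNReal InnerProductSpace RealInnerProductSpace
open Literature.Analysis Literature.Analysis.FluidPDE
open Summit.NavierStokesRegularity.NavierStokesRegularity.Theorems.TypeITraceScarL3
open Summit.NavierStokesRegularity.NavierStokesRegularity.Theorems.QuarterBudgetTraceZoomBudgetInheritance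
open Summit.NavierStokesRegularity.NavierStokesRegularity.Theorems.QuarterBudgetTraceExtinctApexOfFE

/-- **`BudgetedExtinctApex` (stmt-NavierStokesRegularity-26014), BY NAME** (module docstring). -/
theorem budgetedExtinctApex :
    Summit.NavierStokesRegularity.NavierStokesRegularity.Theses.QuarterBudgetTrace.BudgetedExtinctApex := by
  intro ν T hν hT u p hcl hLH hdec K hK x₀ hFE hsing
  have hν0 : ν ≠ 0 := hν.ne'
  have hνi : 0 < ν⁻¹ := inv_pos.2 hν
  have hνT : 0 < ν * T := mul_pos hν hT
  -- ## (1) the velocity Type-I rate from the quarter law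
  have hI : IsTypeIBlowup u T :=
    Summit.NavierStokesRegularity.NavierStokesRegularity.Theorems.lerayQuarterDissipation_recordTimeTypeI_proof
      ν T hν hT u p hcl hLH hdec K hK
  -- ## (2) the singular clause at every radius; the apex is not backward bounded
  have hsing' : ∀ r : ℝ, 0 < r →
      eLpNorm (uncurry u) ⊤ (volume.restrict (parabolicCylinder r ((T : ℝ), x₀))) = ⊤ := by
    intro r hr
    by_cases hrT : r ^ 2 < T
    · exact hsing r hr hrT
    · -- a smaller admissible radius
      set r' : ℝ := Real.sqrt (T / 2) with hr'
      have hr'pos : 0 < r' := Real.sqrt_pos.2 (by positivity)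
      have hr'sq : r' ^ 2 = T / 2 := Real.sq_sqrt (by positivity)
      have hr'T : r' ^ 2 < T := by rw [hr'sq]; linarith
      have hr'r : r' ≤ r := by
        have h1 : r' ^ 2 ≤ r ^ 2 := by linarith [not_lt.1 hrT]
        exact le_of_sq_le_sq h1 hr.le
      have hsub : parabolicCylinder r' ((T : ℝ), x₀) ⊆ parabolicCylinder r ((T : ℝ), x₀) := by
        intro w hw
        rw [mem_parabolicCylinder] at hw ⊢
        refine ⟨⟨?_, hw.1.2⟩, hw.2.trans_le hr'r⟩
        have : r' ^ 2 ≤ r ^ 2 := pow_le_pow_left₀ hr'pos.le hr'r 2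
        linarith [hw.1.1]
      have h := hsing r' hr'pos hr'T
      refine top_le_iff.1 ?_
      calc (⊤ : ℝ≥0∞) = eLpNorm (uncurry u) ⊤ (volume.restrict (parabolicCylinder r' ((T : ℝ), x₀))) := h.symm
        _ ≤ eLpNorm (uncurry u) ⊤ (volume.restrict (parabolicCylinder r ((T : ℝ), x₀))) :=
            eLpNorm_mono_measure _ (Measure.restrict_mono hsub le_rfl)
  have hnotbd : ¬ IsBackwardBoundedAt u T x₀ := not_isBackwardBoundedAt_of_forall_eLpNorm_top hsing'
  -- ## (3) viscosity normalisation `v(s, x) = ν⁻¹ u(s/ν, x)`, blow-up time `νT`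
  set v : ℝ → EuclideanSpace ℝ (Fin 3) → EuclideanSpace ℝ (Fin 3) := timeRescale ν⁻¹ ν⁻¹ u with hv
  set pv : ℝ → EuclideanSpace ℝ (Fin 3) → ℝ := timeRescale ν⁻¹ (ν⁻¹ ^ 2) p with hpv
  have hmaps : MapsTo (fun s => ν⁻¹ * s) (Ico 0 (ν * T)) (Ico 0 T) := by
    intro s hs
    refine ⟨mul_nonneg hνi.le hs.1, ?_⟩
    calc ν⁻¹ * s < ν⁻¹ * (ν * T) := mul_lt_mul_of_pos_left hs.2 hνi
      _ = T := by rw [← mul_assoc, inv_mul_cancel₀ hν0, one_mul]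
  have hclv : IsClassicalNSSolutionOn (Ico 0 (ν * T)) 1 0 v pv := by
    have h := hcl.viscosityRescale_set hν0 hmaps (uniqueDiffOn_Ico 0 (ν * T))
    rwa [timeRescale_zero_force] at h
  have hv0 : ν⁻¹ • u 0 = v 0 := by
    funext x
    simp [hv]
  have hLHv : IsLerayHopfOn (ν * T) 1 0 (v 0) v := by
    have h := hLH.viscosityRescale hνi
    have e1 : T / ν⁻¹ = ν * T := by rw [div_inv_eq_mul, mul_comm]
    rwa [e1, inv_mul_cancel₀ hν0, timeRescale_zero_force, hv0] at h
  -- (3a) the Type-I rate of `v` (verbatim from `stub_extinctApexD_of_L3trace`)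
  have hIv : IsTypeIBlowup v (ν * T) := by
    obtain ⟨C, hC⟩ := hI
    have e0 : ν⁻¹ * (ν * T) = T := by rw [← mul_assoc, inv_mul_cancel₀ hν0, one_mul]
    have htend : Tendsto (fun s : ℝ => ν⁻¹ * s) (𝓝[<] (ν * T)) (𝓝[<] T) := by
      refine tendsto_nhdsWithin_of_tendsto_nhds_of_eventually_within _ ?_ ?_
      · have h := ((continuous_const_mul ν⁻¹).tendsto (ν * T)).mono_left
          (nhdsWithin_le_nhds (s := Iio (ν * T)))
        rwa [e0] at h
      · refine eventually_nhdsWithin_of_forall fun s hs => ?_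
        have h := mul_lt_mul_of_pos_left (mem_Iio.1 hs) hνi
        rwa [e0] at h
    refine ⟨C / Real.sqrt ν, ?_⟩
    filter_upwards [htend.eventually hC, self_mem_nhdsWithin] with s hs hsT x
    have hsT' : s < ν * T := hsT
    have hpos : 0 < ν * T - s := sub_pos.2 hsT'
    have e : T - ν⁻¹ * s = ν⁻¹ * (ν * T - s) := by field_simp
    have hsq : Real.sqrt (T - ν⁻¹ * s) = (Real.sqrt ν)⁻¹ * Real.sqrt (ν * T - s) := by
      rw [e, Real.sqrt_mul hνi.le, Real.sqrt_inv]
    have hb := hs x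
    rw [hsq] at hb
    have hsν : 0 < Real.sqrt ν := Real.sqrt_pos.2 hν
    have hsνsq : Real.sqrt ν * Real.sqrt ν = ν := Real.mul_self_sqrt hν.le
    have hsqpos : 0 < Real.sqrt (ν * T - s) := Real.sqrt_pos.2 hpos
    rw [le_div_iff₀ (by positivity)] at hb
    have hνinv : ν⁻¹ = (Real.sqrt ν)⁻¹ * (Real.sqrt ν)⁻¹ := by rw [← mul_inv, hsνsq]
    have key : ν⁻¹ * ‖u (ν⁻¹ * s) x‖ ≤ C / Real.sqrt ν / Real.sqrt (ν * T - s) := by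
      rw [le_div_iff₀ hsqpos]
      calc ν⁻¹ * ‖u (ν⁻¹ * s) x‖ * Real.sqrt (ν * T - s)
          = (Real.sqrt ν)⁻¹ * (‖u (ν⁻¹ * s) x‖ * ((Real.sqrt ν)⁻¹ * Real.sqrt (ν * T - s))) := by
              rw [hνinv]; ring
        _ ≤ (Real.sqrt ν)⁻¹ * C := mul_le_mul_of_nonneg_left hb (inv_nonneg.2 hsν.le)
        _ = C / Real.sqrt ν := by rw [div_eq_inv_mul]
    have e2 : ‖v s x‖ = ν⁻¹ * ‖u (ν⁻¹ * s) x‖ := by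
      rw [hv, timeRescale_apply, norm_smul, Real.norm_eq_abs, abs_of_pos hνi]
    exact e2 ▸ key
  have hnotbdv : ¬ IsBackwardBoundedAt v (ν * T) x₀ := not_isBackwardBoundedAt_viscosityRescale hν hnotbd
  -- (3b) energy flatness of the final value `v(νT) = ν⁻¹ u(T)`
  have hFEv : Tendsto (fun r : ℝ => r⁻¹ * ∫ x in ball x₀ r, ‖v (ν * T) x‖ ^ 2) (𝓝[>] 0) (𝓝 0) := by
    have e : ∀ r : ℝ, r⁻¹ * ∫ x in ball x₀ r, ‖v (ν * T) x‖ ^ 2 =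
        ν⁻¹ ^ 2 * (r⁻¹ * ∫ x in ball x₀ r, ‖u T x‖ ^ 2) := by
      intro r
      have e1 : ∀ x, ‖v (ν * T) x‖ ^ 2 = ν⁻¹ ^ 2 * ‖u T x‖ ^ 2 := fun x => by
        rw [hv, timeRescale_apply, ← mul_assoc, inv_mul_cancel₀ hν0, one_mul, norm_smul, Real.norm_eq_abs,
          abs_of_pos hνi, mul_pow]
      simp_rw [e1, integral_const_mul]
      ring
    simp_rw [e]
    have h := hFE.const_mul (ν⁻¹ ^ 2)
    rwa [mul_zero] at h
  -- (3c) the quarter law for `v`: `∫⁻ |curl v(s)|² ≤ K_v/√(νT − s)`, `K_v = ν⁻² √ν K⁺`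
  set Kv : ℝ := ν⁻¹ ^ 2 * Real.sqrt ν * max K 0 with hKv
  have hKv_law : ∀ s ∈ Ico 0 (ν * T), ∫⁻ x, ‖curl (v s) x‖ₑ ^ 2 ≤ ENNReal.ofReal (Kv / Real.sqrt (ν * T - s)) := by
    intro s hs
    have ht : ν⁻¹ * s ∈ Ico 0 T := hmaps hs
    have hcurl : ∀ x, curl (v s) x = ν⁻¹ • curl (u (ν⁻¹ * s)) x := fun x => by
      rw [hv, timeRescale_slice]
      exact curl_const_smul_field ν⁻¹ (u (ν⁻¹ * s)) x
    have e1 : ∀ x, (‖curl (v s) x‖ₑ : ℝ≥0∞) ^ 2 = ENNReal.ofReal (ν⁻¹ ^ 2) * ‖curl (u (ν⁻¹ * s)) x‖ₑ ^ 2 := by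
      intro x
      rw [hcurl x, enorm_smul, mul_pow, Real.enorm_eq_ofReal hνi.le, ENNReal.ofReal_pow hνi.le]
    simp_rw [e1]
    rw [lintegral_const_mul' _ _ ENNReal.ofReal_ne_top]
    have hpos : 0 < ν * T - s := sub_pos.2 hs.2
    have hsq : Real.sqrt (T - ν⁻¹ * s) = (Real.sqrt ν)⁻¹ * Real.sqrt (ν * T - s) := by
      have e : T - ν⁻¹ * s = ν⁻¹ * (ν * T - s) := by field_simp
      rw [e, Real.sqrt_mul hνi.le, Real.sqrt_inv]
    have hsν : 0 < Real.sqrt ν := Real.sqrt_pos.2 hν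
    calc ENNReal.ofReal (ν⁻¹ ^ 2) * ∫⁻ x, ‖curl (u (ν⁻¹ * s)) x‖ₑ ^ 2
        ≤ ENNReal.ofReal (ν⁻¹ ^ 2) * ENNReal.ofReal (K / Real.sqrt (T - ν⁻¹ * s)) := by
          gcongr
          exact hK _ ht
      _ ≤ ENNReal.ofReal (ν⁻¹ ^ 2) * ENNReal.ofReal (max K 0 / Real.sqrt (T - ν⁻¹ * s)) := by
          gcongr
          exact le_max_left _ _
      _ = ENNReal.ofReal (Kv / Real.sqrt (ν * T - s)) := by
          rw [← ENNReal.ofReal_mul (by positivity), hsq, hKv]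
          congr 1
          field_simp
  -- ## (4) the extinct apex with plain pressure bound and zoom data (brick (b)), rate constant `C₁ = max C 0 ≥ 0`
  obtain ⟨C, hC⟩ := hIv
  set C₁ : ℝ := max C 0 with hC₁
  have hC₁0 : 0 ≤ C₁ := le_max_right _ _
  have hrate₁ : ∀ᶠ s in 𝓝[<] (ν * T), ∀ x, ‖v s x‖ ≤ C₁ / Real.sqrt (ν * T - s) := by
    filter_upwards [hC, self_mem_nhdsWithin] with s hs hsT x
    have hsT' : s < ν * T := hsT
    refine (hs x).trans ?_
    gcongr
    exact le_max_left _ _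
  obtain ⟨μ, U, P, G, M, D₀, hμ, hμ0, h1, h2, h3, h4, h5, h6, h7, hconv⟩ :=
    extinctApexD_zoomData_unit_const_of_FE hνT hclv hLHv hC₁0 hrate₁ x₀ hnotbdv hFEv
  -- ## (5) the budget (brick (a))
  have hGfin : ∀ a : ℝ, 0 < a →
      ∫⁻ z in parabolicCylinder a (0 : ℝ × EuclideanSpace ℝ (Fin 3)),
        ENNReal.ofReal (frobeniusNormSq (G z.1 z.2)) < ⊤ := by
    intro a ha
    have hE : cknE a (0 : ℝ × EuclideanSpace ℝ (Fin 3)) G ≤ M :=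
      cknE_le_abScaledSum.trans ((abScaledSum_le_typeIBound ha subset_rfl).trans (h3 a ha))
    have ha0 : ENNReal.ofReal a ≠ 0 := (ENNReal.ofReal_pos.2 ha).ne'
    have ha0' : ENNReal.ofReal a ≠ ⊤ := ENNReal.ofReal_ne_top
    have hle : ∫⁻ z in parabolicCylinder a (0 : ℝ × EuclideanSpace ℝ (Fin 3)),
        ENNReal.ofReal (frobeniusNormSq (G z.1 z.2)) ≤ ENNReal.ofReal a * M :=
      (ENNReal.inv_mul_le_iff ha0 ha0').1 hE
    exact lt_of_le_of_lt hle (ENNReal.mul_lt_top ENNReal.ofReal_lt_top ENNReal.coe_lt_top)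
  have hbud := slabBudget_of_zoomLimit hνT hclv hLHv hKv_law x₀ hμ hμ0 h2 hGfin hconv
  -- ## (6) assemble
  exact ⟨U, P, G, M, D₀, C₁, 2 * max Kv 0, h1, h2, h3, h4, h5, h6, hbud, h7⟩

end Summit.NavierStokesRegularity.NavierStokesRegularity.Theorems.QuarterBudgetTraceBudgetedExtinctApex

end
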